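import Summits.QuantumFields.YangMills.Theorems.MirrorModularBoostsHypercubicLimitPeelReflHermRP
import Summits.QuantumFields.YangMills.Theorems.MirrorModularBoostsHypercubicLimitPeelReflHypercubic
import Summits.QuantumFields.YangMills.Theorems.MirrorModularBoostsHypercubicLimitPeelRpPos
import Summits.QuantumFields.YangMills.Theorems.MirrorModularBoostsHypercubicLimitPeelDecayOfSlabClustering
import Summits.QuantumFields.YangMills.Theorems.PencilRigidityWeakCouplingHypercubicLimitIRInputsOfColdPressure
import Summits.QuantumFields.YangMills.Theorems.MirrorModularBoostsHypercubicLimitPeelOfLineInputs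
import HarnessLib

/-!
# Crux `HypercubicLimit` (stmt-QuantumFields-16154), line `peel-and-disseminate`: (R) the reflection leg of the host closure, assembled

Support file (c3 seat).  The reflection leg (R) `ReflectionLegsP` of the host closure (crux stmt-QuantumFields-8646, line
`conditional-mean-telescoping`, vocabulary `PencilRigidityHypercubicLimitDefs(B).lean`: for every `(G, r)` with `GapData` there is
a torus demand `Λ` such that every `SoftData` witness obeying it, with `PolyRenorm`, is OS-hermitian, reflection positive, clusters
(E4), is invariant under the proper signed permutations on `⁰𝒮`, and has `HasMassGap 1`) is a THEOREM: `reflectionLegsP_holds`.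

Assembly of the line's landed pieces:
* (R1) `stub_reflHermRP` (`…PeelReflHermRP.lean`, p140213) — hermiticity + E2 via the RP-adapted family `rpFam`;
* (R2) `stub_reflHypercubic` (`…PeelReflHypercubic.lean`, p140468) — all signed permutations (`signedPerm_of_torusBound`);
* (R3) `stub_reflGapCluster` — E4 + `HasMassGap 1`, proved HERE as the glue `reflGapCluster_of_pieces` over (R3a) `stub_rpPos`
  (`…PeelRpPos.lean`, p141221: `RPPos` of the limit) and (R3b) `stub_decayOfSlabClustering` (`…PeelDecayOfSlabClustering.lean`,
  p143839: `Decay S₁ 1` from the RP-spectral slab clustering of `GapData` (iii) along the scheme), fed — with E0-normalisation and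
  translation invariance from `SoftData` — to the landed continuum assembly `reflHalf_of_pieces` (twin crux 16120,
  `PencilRigidityWeakCouplingHypercubicLimitIRInputsOfColdPressure.lean`).  The torus demand of (R3) is
  `Λ₃(β, k) = max (rhDemand m β k) (S₀(β, k))`, `S₀` making the thermal slack `ε_β(S)` of `GapData` (iii) at most `m(β)^k`, so that
  along the scheme it is `≤ a_k^k = O(a_k^∞)` against the polynomial sup norms of the lattice functionals;
* `reflectionLegsP_of_chosenDemands` — pure logic: the three pieces each CHOOSE a demand (unlike the ∀Λ form
  `reflectionLegsP_of_pieces` of `…PeelOfLineInputs.lean`), the composed demand is their pointwise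
  maximum (`SoftData` is antitone in the demand, `softData_anti`).

Refs: OsterwalderSchrader1973 §§3–4; OsterwalderSchrader1975 §4; OsterwalderSeiler1978 §§2–3; GlimmJaffe1987 §6.1, §19.7;
`Cruxes/HypercubicLimit/CONSULT-c1-softdata.md` (the ε-absorption by the demand, with `PolyRenorm`).
-/

set_option autoImplicit false

noncomputable section

open scoped SchwartzMap ENNReal
open MeasureTheory Filter Topology
open Literature.MathematicalPhysics.AQFT Literature.MathematicalPhysics.QuantumLattice
open Literature.MathematicalPhysics.QuantumFieldTheory
open Literature.Probability.LatticeModels (box Site)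
open Summit.QuantumFields.YangMills.Theorems.HypercubicLimit.Negative (torusPlaquette influence exterior)
open Summit.QuantumFields.YangMills.Cruxes.HypercubicLimit.ConditionalMeanTelescoping
  (GapData SoftData PolyRenorm ReflectionLegsP CornerFreeInfluence WindowRegularity NonGaussianFloor LatticeGapInput)
open Summit.QuantumFields.YangMills.Cruxes.OSLegsFromFemtoAndGap.DlrCollarTransfer (RPPos Decay)
open Summit.QuantumFields.YangMills.Theorems.WeakCouplingHypercubicLimit.TraceNormColdPressure (reflHalf_of_pieces)

namespace Summit.QuantumFields.YangMills.Cruxes.HypercubicLimit.PeelAndDisseminate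

/-! ## §1 (R3) E4 and the continuum gap: glue over the two landed pieces

(R1) `stub_reflHermRP` (p140213), (R2) `stub_reflHypercubic` (p140468), (R3a) `stub_rpPos` (p141221) and (R3b)
`stub_decayOfSlabClustering` (p143839; helpers p142712, p143612, p143008) are LANDED (imported).  (R3) goes through the landed
continuum assembly `reflHalf_of_pieces` (twin crux 16120, `PencilRigidityWeakCouplingHypercubicLimitIRInputsOfColdPressure`):
`ReflHalf S₁ 1` (⊇ E4 ∧ `HasMassGap 1`) from E0-normalisation and translation invariance on `⁰𝒮` (both in `SoftData`),
signed-permutation invariance on `⁰𝒮` (LANDED `signedPerm_of_torusBound`, R2's file), `RPPos S₁` (R3a) and `Decay S₁ 1` (R3b).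
So (R) `ReflectionLegsP` is a THEOREM (`reflectionLegsP_holds`, §2). -/

/-- **(R3) E4 and `HasMassGap 1` from its two pieces** (glue).  The torus demand
is `Λ₃(β, k) = max (rhDemand m β k) (S₀(β, k))` where `S₀(β, k)` makes the thermal slack of `GapData` (iii) at most `m(β)^k`
(`ε_β(S) → 0` for `β ≥ β₁`), so that along a scheme obeying it the slack `ε_{β_k}(L_k) ≤ a_k^k` dies against every power of
`a_k` (units `a_k = m(β_k) → 0`).  Then: `RPPos S₁` (R3a), `Decay S₁ 1` (R3b), signed permutations (LANDED
`signedPerm_of_torusBound`), E0-normalisation `S₁ 0 = δ` and translation invariance on `⁰𝒮` (from `SoftData`: plane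
expansion + invariance of every `Spl n q`) feed the LANDED `reflHalf_of_pieces` at `Δ = 1`, whose conclusion `ReflHalf S₁ 1`
contains E4 and `HasMassGap 1`.  (Hermiticity and E2 are not even needed as inputs here; they are re-derived.) -/
theorem reflGapCluster_of_pieces
    (hA : ∀ (G : Type) [Group G] [TopologicalSpace G] [IsTopologicalGroup G] [CompactSpace G]
      [MeasurableSpace G] [BorelSpace G] (r : LatticeRep G) (β₁ C₁ c₂ : ℝ) (m : ℝ → ℝ), GapData G r β₁ C₁ c₂ m →
      ∀ (δ₀ : ℝ) (Λ : ℝ → ℕ → ℕ) (sch : SpeciesScheme (YMSpecies G)) (S₁ : SchwingerFamily (EuclideanSpace ℝ (Fin 4)))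
        (Spl : (n : ℕ) → (Fin n → Fin 4 × Fin 4) → (𝓢((Fin n → (EuclideanSpace ℝ (Fin 4))), ℂ) →L[ℂ] ℂ)),
        SoftData r m δ₀ Λ sch S₁ Spl → PolyRenorm r sch →
        (∀ k, 1 ≤ sch.L k) → (∀ k, (sch.a k)⁻¹ * (sch.a k)⁻¹ ≤ (sch.L k : ℝ)) → RPPos S₁)
    (hB : ∀ (G : Type) [Group G] [TopologicalSpace G] [IsTopologicalGroup G] [CompactSpace G]
      [MeasurableSpace G] [BorelSpace G] (r : LatticeRep G) (β₁ C₁ c₂ : ℝ) (m : ℝ → ℝ), GapData G r β₁ C₁ c₂ m →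
      ∀ (δ₀ : ℝ) (Λ : ℝ → ℕ → ℕ) (sch : SpeciesScheme (YMSpecies G)) (S₁ : SchwingerFamily (EuclideanSpace ℝ (Fin 4)))
        (Spl : (n : ℕ) → (Fin n → Fin 4 × Fin 4) → (𝓢((Fin n → (EuclideanSpace ℝ (Fin 4))), ℂ) →L[ℂ] ℂ)),
        SoftData r m δ₀ Λ sch S₁ Spl → PolyRenorm r sch →
        (∀ k, 1 ≤ sch.L k) → (∀ k, (sch.a k)⁻¹ * (sch.a k)⁻¹ ≤ (sch.L k : ℝ)) →
        ∀ ε : ℕ → ℝ, (∀ p : ℕ, Tendsto (fun k => ε k * (sch.a k)⁻¹ ^ p) atTop (𝓝 0)) →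
          (∀ᶠ k in atTop, ∀ (T n : ℕ), 2 * (T + n + 1) ≤ sch.L k →
            ∀ (Y : LGConfig 4 G → ℝ) (B : ℝ), Measurable Y → (∀ U, |Y U| ≤ B) →
              DependsOn Y {e : Literature.MathematicalPhysics.QuantumLattice.ZdEdge 4 |
                  1 ≤ e.1 0 ∧ e.1 0 + (if e.2 = 0 then 1 else 0) ≤ T} →
                |(∫ U, Y (torusLift (2 * sch.L k + 1) (GaugeConfig.timeReflect U)) *
                      Y (configShift (-Pi.single 0 (n : ℤ)) (torusLift (2 * sch.L k + 1) U))
                    ∂(wilsonMeasure r.ρ (sch.β k) : Measure (GaugeConfig 4 (2 * sch.L k + 1) G))) -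
                  (∫ U, Y (torusLift (2 * sch.L k + 1) U)
                    ∂(wilsonMeasure r.ρ (sch.β k) : Measure (GaugeConfig 4 (2 * sch.L k + 1) G))) ^ 2| ≤
                  Real.exp (-(m (sch.β k) * n)) *
                      ((∫ U, Y (torusLift (2 * sch.L k + 1) (GaugeConfig.timeReflect U)) *
                            Y (torusLift (2 * sch.L k + 1) U)
                          ∂(wilsonMeasure r.ρ (sch.β k) : Measure (GaugeConfig 4 (2 * sch.L k + 1) G))) -
                        (∫ U, Y (torusLift (2 * sch.L k + 1) U)
                          ∂(wilsonMeasure r.ρ (sch.β k) : Measure (GaugeConfig 4 (2 * sch.L k + 1) G))) ^ 2) +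
                    ε k * B ^ 2) →
          Decay S₁ 1) :
    ∀ (G : Type) [Group G] [TopologicalSpace G] [IsTopologicalGroup G] [CompactSpace G]
      [MeasurableSpace G] [BorelSpace G], IsCompactSimpleLieGroup G →
      ∀ (r : LatticeRep G) (β₁ C₁ c₂ : ℝ) (m : ℝ → ℝ), GapData G r β₁ C₁ c₂ m →
        ∃ Λ : ℝ → ℕ → ℕ, ∀ (δ₀ : ℝ) (sch : SpeciesScheme (YMSpecies G)) (S₁ : SchwingerFamily (EuclideanSpace ℝ (Fin 4)))
          (Spl : (n : ℕ) → (Fin n → Fin 4 × Fin 4) → (𝓢((Fin n → (EuclideanSpace ℝ (Fin 4))), ℂ) →L[ℂ] ℂ)),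
          0 < δ₀ → SoftData r m δ₀ Λ sch S₁ Spl → PolyRenorm r sch →
            S₁.toLabelled.IsHermitian → S₁.toLabelled.IsReflectionPositive →
              S₁.toLabelled.HasClusterProperty ∧ S₁.toLabelled.HasMassGap 1 := by
  classical
  intro G _ _ _ _ _ _ _ r β₁ C₁ c₂ m hgap
  -- §a  the thermal slack of `GapData` (iii), chosen for every `β` (junk below `β₁`)
  have hch : ∀ β : ℝ, ∃ ε : ℕ → ℝ, β₁ ≤ β → (Tendsto ε atTop (𝓝 0) ∧
      ∀ (S T n : ℕ), 2 * (T + n + 1) ≤ S →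
        ∀ (Y : LGConfig 4 G → ℝ) (B : ℝ), Measurable Y → (∀ U, |Y U| ≤ B) →
          DependsOn Y {e : Literature.MathematicalPhysics.QuantumLattice.ZdEdge 4 |
              1 ≤ e.1 0 ∧ e.1 0 + (if e.2 = 0 then 1 else 0) ≤ T} →
            |(∫ U, Y (torusLift (2 * S + 1) (GaugeConfig.timeReflect U)) *
                  Y (configShift (-Pi.single 0 (n : ℤ)) (torusLift (2 * S + 1) U))
                ∂(wilsonMeasure r.ρ β : Measure (GaugeConfig 4 (2 * S + 1) G))) -
              (∫ U, Y (torusLift (2 * S + 1) U) ∂(wilsonMeasure r.ρ β : Measure (GaugeConfig 4 (2 * S + 1) G))) ^ 2| ≤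
              Real.exp (-(m β * n)) *
                  ((∫ U, Y (torusLift (2 * S + 1) (GaugeConfig.timeReflect U)) * Y (torusLift (2 * S + 1) U)
                      ∂(wilsonMeasure r.ρ β : Measure (GaugeConfig 4 (2 * S + 1) G))) -
                    (∫ U, Y (torusLift (2 * S + 1) U) ∂(wilsonMeasure r.ρ β : Measure (GaugeConfig 4 (2 * S + 1) G))) ^ 2) +
                ε S * B ^ 2) := by
    intro β
    by_cases hβ : β₁ ≤ β
    · obtain ⟨ε, hε0, hε⟩ := hgap.2.2.2.1 β hβ
      exact ⟨ε, fun _ => ⟨hε0, fun S T n hS Y B hY hB hdep => hε S T n hS Y B hY hB hdep⟩⟩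
    · exact ⟨fun _ => 0, fun h => absurd h hβ⟩
  choose ε hε using hch
  -- §b  the threshold making the slack at most `m(β)^k`
  have hth : ∀ (β : ℝ) (k : ℕ), ∃ S₀ : ℕ, β₁ ≤ β → ∀ S : ℕ, S₀ ≤ S → |ε β S| ≤ m β ^ k := by
    intro β k
    by_cases hβ : β₁ ≤ β
    · have h0 : Tendsto (fun S => |ε β S|) atTop (𝓝 0) := by
        simpa only [abs_zero] using ((hε β hβ).1).abs
      have hev : ∀ᶠ S in atTop, |ε β S| ≤ m β ^ k := h0.eventually_le_const (pow_pos (hgap.1 β hβ) k)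
      obtain ⟨S₀, hS₀⟩ := eventually_atTop.1 hev
      exact ⟨S₀, fun _ => hS₀⟩
    · exact ⟨0, fun h => absurd h hβ⟩
  choose S₀ hS₀ using hth
  refine ⟨fun β k => max (rhDemand m β k) (S₀ β k), fun δ₀ sch S₁ Spl _ hD hP _ _ => ?_⟩
  -- §c  bookkeeping along the scheme
  have hΛ : ∀ k, max (rhDemand m (sch.β k) k) (S₀ (sch.β k) k) ≤ sch.L k := hD.2.2.1
  have hunits : ∀ k, sch.a k = m (sch.β k) := hD.1
  have hβ : Tendsto sch.β atTop atTop := hD.2.1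
  have hL1 : ∀ k, 1 ≤ sch.L k := fun k =>
    le_trans (le_trans (le_max_left _ _) (le_max_left _ _)) (hΛ k)
  have hL2 : ∀ k, (sch.a k)⁻¹ * (sch.a k)⁻¹ ≤ (sch.L k : ℝ) := fun k => by
    rw [hunits k]
    calc (m (sch.β k))⁻¹ * (m (sch.β k))⁻¹ ≤ (⌈(m (sch.β k))⁻¹ * (m (sch.β k))⁻¹⌉₊ : ℝ) := Nat.le_ceil _
      _ ≤ (rhDemand m (sch.β k) k : ℝ) := by
          unfold rhDemand
          exact_mod_cast le_max_right _ _
      _ ≤ sch.L k := by exact_mod_cast le_trans (le_max_left _ _) (hΛ k)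
  have hS₀L : ∀ k, S₀ (sch.β k) k ≤ sch.L k := fun k => le_trans (le_max_right _ _) (hΛ k)
  have ha0 : Tendsto sch.a atTop (𝓝 0) := (hgap.2.1.comp hβ).congr fun k => (hunits k).symm
  have hβ₁ : ∀ᶠ k in atTop, β₁ ≤ sch.β k := hβ.eventually_ge_atTop β₁
  have hapos : ∀ᶠ k in atTop, 0 < sch.a k := hβ₁.mono fun k hk => by rw [hunits k]; exact hgap.1 _ hk
  have ha1 : ∀ᶠ k in atTop, sch.a k ≤ 1 := ha0.eventually_le_const one_pos
  -- §d  the slack sequence along the scheme and its super-polynomial decay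
  set ε' : ℕ → ℝ := fun k => |ε (sch.β k) (sch.L k)| with hε'
  have hε'le : ∀ᶠ k in atTop, ε' k ≤ sch.a k ^ k := by
    filter_upwards [hβ₁] with k hk
    rw [hε', hunits k]
    exact hS₀ (sch.β k) k hk (sch.L k) (hS₀L k)
  have hε'poly : ∀ p : ℕ, Tendsto (fun k => ε' k * (sch.a k)⁻¹ ^ p) atTop (𝓝 0) := by
    intro p
    refine squeeze_zero' (Eventually.of_forall fun k =>
      mul_nonneg (abs_nonneg _) (pow_nonneg (inv_nonneg.2 (sch.a_pos k).le) p)) ?_ ha0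
    filter_upwards [hε'le, hapos, ha1, eventually_ge_atTop (p + 1)] with k hk hk0 hk1 hkp
    calc ε' k * (sch.a k)⁻¹ ^ p ≤ sch.a k ^ k * (sch.a k)⁻¹ ^ p :=
          mul_le_mul_of_nonneg_right hk (pow_nonneg (inv_nonneg.2 hk0.le) p)
      _ = sch.a k ^ (k - p) := by
          rw [inv_pow, pow_sub₀ _ hk0.ne' (by omega)]
      _ ≤ sch.a k ^ 1 := pow_le_pow_of_le_one hk0.le hk1 (by omega)
      _ = sch.a k := pow_one _
  have hslab : ∀ᶠ k in atTop, ∀ (T n : ℕ), 2 * (T + n + 1) ≤ sch.L k →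
      ∀ (Y : LGConfig 4 G → ℝ) (B : ℝ), Measurable Y → (∀ U, |Y U| ≤ B) →
        DependsOn Y {e : Literature.MathematicalPhysics.QuantumLattice.ZdEdge 4 |
            1 ≤ e.1 0 ∧ e.1 0 + (if e.2 = 0 then 1 else 0) ≤ T} →
          |(∫ U, Y (torusLift (2 * sch.L k + 1) (GaugeConfig.timeReflect U)) *
                Y (configShift (-Pi.single 0 (n : ℤ)) (torusLift (2 * sch.L k + 1) U))
              ∂(wilsonMeasure r.ρ (sch.β k) : Measure (GaugeConfig 4 (2 * sch.L k + 1) G))) -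
            (∫ U, Y (torusLift (2 * sch.L k + 1) U)
              ∂(wilsonMeasure r.ρ (sch.β k) : Measure (GaugeConfig 4 (2 * sch.L k + 1) G))) ^ 2| ≤
            Real.exp (-(m (sch.β k) * n)) *
                ((∫ U, Y (torusLift (2 * sch.L k + 1) (GaugeConfig.timeReflect U)) *
                      Y (torusLift (2 * sch.L k + 1) U)
                    ∂(wilsonMeasure r.ρ (sch.β k) : Measure (GaugeConfig 4 (2 * sch.L k + 1) G))) -
                  (∫ U, Y (torusLift (2 * sch.L k + 1) U)
                    ∂(wilsonMeasure r.ρ (sch.β k) : Measure (GaugeConfig 4 (2 * sch.L k + 1) G))) ^ 2) +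
              ε' k * B ^ 2 := by
    filter_upwards [hβ₁] with k hk T n hTn Y B hY hB hdep
    exact le_trans ((hε (sch.β k) hk).2 (sch.L k) T n hTn Y B hY hB hdep)
      (add_le_add le_rfl (mul_le_mul_of_nonneg_right (le_abs_self _) (sq_nonneg B)))
  -- §e  the pieces
  have hRPpos : RPPos S₁ := hA G r β₁ C₁ c₂ m hgap δ₀ _ sch S₁ Spl hD hP hL1 hL2
  have hDec : Decay S₁ 1 := hB G r β₁ C₁ c₂ m hgap δ₀ _ sch S₁ Spl hD hP hL1 hL2 ε' hε'poly hslab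
  have hsigned : ∀ (n : ℕ) (R : EuclideanSpace ℝ (Fin 4) ≃ₗᵢ[ℝ] EuclideanSpace ℝ (Fin 4)),
      (∀ i : Fin 4, ∃ j : Fin 4, R (EuclideanSpace.single i 1) = EuclideanSpace.single j 1 ∨
        R (EuclideanSpace.single i 1) = -EuclideanSpace.single j 1) →
      ∀ F : 𝓢((Fin n → EuclideanSpace ℝ (Fin 4)), ℂ), IsOffDiagonal F → S₁ n (linActMulti R F) = S₁ n F :=
    fun n R hR F hF => signedPerm_of_torusBound r hgap hD hP (Eventually.of_forall hL2) n R hR F hF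
  obtain ⟨-, -, -, -, -, -, -, -, hexp, hS0, hS1, -, -, htransl⟩ := hD
  have hN : S₁.toLabelled.IsNormalized := fun k F => by
    rw [SchwingerFamily.toLabelled_apply]; exact (hS0 F).trans (congrArg F (Subsingleton.elim _ _))
  have htrans : ∀ (n : ℕ) (k : Fin n → Unit) (a : EuclideanSpace ℝ (Fin 4))
      (F : 𝓢((Fin n → EuclideanSpace ℝ (Fin 4)), ℂ)), IsOffDiagonal F →
      S₁.toLabelled n k (translateMulti a F) = S₁.toLabelled n k F := by
    intro n k a F hF
    simp only [SchwingerFamily.toLabelled_apply]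
    rcases Nat.lt_or_ge n 2 with hn | hn
    · interval_cases n
      · rw [hS0, hS0, translateMulti_apply]
        exact congrArg F (Subsingleton.elim _ _)
      · rw [hS1, hS1]
    · rw [hexp n hn _ (hF.translateMulti a), hexp n hn F hF]
      exact Finset.sum_congr rfl fun q _ => htransl n q a F hF
  have hRH := reflHalf_of_pieces S₁ one_pos hN htrans hRPpos hsigned hDec
  exact ⟨hRH.2.2.1, hRH.2.2.2.2⟩

/-- **(R3) E4 and the continuum mass gap at rate `1` of the `SoftData` limits** (the line's registered piece (R3), reshape 2
signature): for every `(G, r)` with gap data there is a torus demand `Λ` such that every `SoftData` witness obeying it, with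
`PolyRenorm`, clusters (E4) and has `HasMassGap 1` — `reflGapCluster_of_pieces` over the landed (R3a) `stub_rpPos` and (R3b)
`stub_decayOfSlabClustering`.  (The hermiticity / E2 hypotheses of the registered signature are idle: `reflHalf_of_pieces`
re-derives them.) -/
theorem stub_reflGapCluster :
    ∀ (G : Type) [Group G] [TopologicalSpace G] [IsTopologicalGroup G] [CompactSpace G]
      [MeasurableSpace G] [BorelSpace G], IsCompactSimpleLieGroup G →
      ∀ (r : LatticeRep G) (β₁ C₁ c₂ : ℝ) (m : ℝ → ℝ), GapData G r β₁ C₁ c₂ m →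
        ∃ Λ : ℝ → ℕ → ℕ, ∀ (δ₀ : ℝ) (sch : SpeciesScheme (YMSpecies G)) (S₁ : SchwingerFamily (EuclideanSpace ℝ (Fin 4)))
          (Spl : (n : ℕ) → (Fin n → Fin 4 × Fin 4) → (𝓢((Fin n → (EuclideanSpace ℝ (Fin 4))), ℂ) →L[ℂ] ℂ)),
          0 < δ₀ → SoftData r m δ₀ Λ sch S₁ Spl → PolyRenorm r sch →
            S₁.toLabelled.IsHermitian → S₁.toLabelled.IsReflectionPositive →
              S₁.toLabelled.HasClusterProperty ∧ S₁.toLabelled.HasMassGap 1 :=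
  reflGapCluster_of_pieces stub_rpPos stub_decayOfSlabClustering


/-! ## §2 (R) assembled -/

/-- **(R) from its three pieces, each choosing its torus demand** (pure logic): `ReflectionLegsP` — the SAME statement as the open
registered stub `stub_reflectionLegs` of crux stmt-QuantumFields-8646 — from (R1) hermiticity + RP, (R2) proper-hypercubic
invariance, (R3) E4 + `HasMassGap 1`, EACH choosing its own torus demand; the composed demand is their pointwise maximum
(`SoftData` is antitone in the demand, LANDED `softData_anti`, p140083). -/
theorem reflectionLegsP_of_chosenDemands
    (h1 : ∀ (G : Type) [Group G] [TopologicalSpace G] [IsTopologicalGroup G] [CompactSpace G]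
      [MeasurableSpace G] [BorelSpace G], IsCompactSimpleLieGroup G →
      ∀ (r : LatticeRep G) (β₁ C₁ c₂ : ℝ) (m : ℝ → ℝ), GapData G r β₁ C₁ c₂ m →
        ∃ Λ : ℝ → ℕ → ℕ, ∀ (δ₀ : ℝ) (sch : SpeciesScheme (YMSpecies G)) (S₁ : SchwingerFamily (EuclideanSpace ℝ (Fin 4)))
          (Spl : (n : ℕ) → (Fin n → Fin 4 × Fin 4) → (𝓢((Fin n → (EuclideanSpace ℝ (Fin 4))), ℂ) →L[ℂ] ℂ)),
          0 < δ₀ → SoftData r m δ₀ Λ sch S₁ Spl → PolyRenorm r sch →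
            S₁.toLabelled.IsHermitian ∧ S₁.toLabelled.IsReflectionPositive)
    (h2 : ∀ (G : Type) [Group G] [TopologicalSpace G] [IsTopologicalGroup G] [CompactSpace G]
      [MeasurableSpace G] [BorelSpace G], IsCompactSimpleLieGroup G →
      ∀ (r : LatticeRep G) (β₁ C₁ c₂ : ℝ) (m : ℝ → ℝ), GapData G r β₁ C₁ c₂ m →
        ∃ Λ : ℝ → ℕ → ℕ, ∀ (δ₀ : ℝ) (sch : SpeciesScheme (YMSpecies G)) (S₁ : SchwingerFamily (EuclideanSpace ℝ (Fin 4)))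
          (Spl : (n : ℕ) → (Fin n → Fin 4 × Fin 4) → (𝓢((Fin n → (EuclideanSpace ℝ (Fin 4))), ℂ) →L[ℂ] ℂ)),
          0 < δ₀ → SoftData r m δ₀ Λ sch S₁ Spl → PolyRenorm r sch →
            ∀ (n : ℕ) (k : Fin n → Unit) (R : (EuclideanSpace ℝ (Fin 4)) ≃ₗᵢ[ℝ] (EuclideanSpace ℝ (Fin 4))),
              LinearMap.det (R.toLinearEquiv : (EuclideanSpace ℝ (Fin 4)) →ₗ[ℝ] (EuclideanSpace ℝ (Fin 4))) = 1 →
              (∀ i : Fin 4, ∃ j : Fin 4, R (EuclideanSpace.single i 1) = EuclideanSpace.single j 1 ∨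
                R (EuclideanSpace.single i 1) = -EuclideanSpace.single j 1) →
              ∀ F : 𝓢((Fin n → (EuclideanSpace ℝ (Fin 4))), ℂ), IsOffDiagonal F →
                S₁.toLabelled n k (linActMulti R F) = S₁.toLabelled n k F)
    (h3 : ∀ (G : Type) [Group G] [TopologicalSpace G] [IsTopologicalGroup G] [CompactSpace G]
      [MeasurableSpace G] [BorelSpace G], IsCompactSimpleLieGroup G →
      ∀ (r : LatticeRep G) (β₁ C₁ c₂ : ℝ) (m : ℝ → ℝ), GapData G r β₁ C₁ c₂ m →
        ∃ Λ : ℝ → ℕ → ℕ, ∀ (δ₀ : ℝ) (sch : SpeciesScheme (YMSpecies G)) (S₁ : SchwingerFamily (EuclideanSpace ℝ (Fin 4)))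
          (Spl : (n : ℕ) → (Fin n → Fin 4 × Fin 4) → (𝓢((Fin n → (EuclideanSpace ℝ (Fin 4))), ℂ) →L[ℂ] ℂ)),
          0 < δ₀ → SoftData r m δ₀ Λ sch S₁ Spl → PolyRenorm r sch →
            S₁.toLabelled.IsHermitian → S₁.toLabelled.IsReflectionPositive →
              S₁.toLabelled.HasClusterProperty ∧ S₁.toLabelled.HasMassGap 1) :
    ReflectionLegsP := by
  intro G _ _ _ _ _ _ hG r β₁ C₁ c₂ m hgap
  obtain ⟨Λ₁, hΛ₁⟩ := h1 G hG r β₁ C₁ c₂ m hgap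
  obtain ⟨Λ₂, hΛ₂⟩ := h2 G hG r β₁ C₁ c₂ m hgap
  obtain ⟨Λ₃, hΛ₃⟩ := h3 G hG r β₁ C₁ c₂ m hgap
  refine ⟨fun β k => max (Λ₁ β k) (max (Λ₂ β k) (Λ₃ β k)), fun δ₀ sch S₁ Spl hδ₀ hD hP => ?_⟩
  have hD₁ : SoftData r m δ₀ Λ₁ sch S₁ Spl :=
    softData_anti r m δ₀ sch S₁ Spl (fun β k => le_max_left _ _) hD
  have hD₂ : SoftData r m δ₀ Λ₂ sch S₁ Spl :=
    softData_anti r m δ₀ sch S₁ Spl (fun β k => (le_max_left _ _).trans (le_max_right _ _)) hD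
  have hD₃ : SoftData r m δ₀ Λ₃ sch S₁ Spl :=
    softData_anti r m δ₀ sch S₁ Spl (fun β k => (le_max_right _ _).trans (le_max_right _ _)) hD
  obtain ⟨hherm, hRP⟩ := hΛ₁ δ₀ sch S₁ Spl hδ₀ hD₁ hP
  obtain ⟨hcl, hgap1⟩ := hΛ₃ δ₀ sch S₁ Spl hδ₀ hD₃ hP hherm hRP
  exact ⟨hherm, hRP, hcl, hΛ₂ δ₀ sch S₁ Spl hδ₀ hD₂ hP, hgap1⟩

/-- **(R) The reflection leg of the host closure is a theorem**: `ReflectionLegsP` — the SAME statement as the open registered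
stub `stub_reflectionLegs` of crux stmt-QuantumFields-8646 — from (R1) `stub_reflHermRP`, (R2) `stub_reflHypercubic`,
(R3) `stub_reflGapCluster`. -/
theorem reflectionLegsP_holds : ReflectionLegsP :=
  reflectionLegsP_of_chosenDemands stub_reflHermRP stub_reflHypercubic stub_reflGapCluster

/-! ## §3 The crux from the line's three physics inputs -/

/-- **The crux `HypercubicLimit` from the line's PHYSICS inputs alone** (the reflection leg (R) being discharged by
`reflectionLegsP_holds`): the blanket product bound (F′) (UV bet of the line), the corner-free influence window (WI₂) (UV),
and the host's IR sockets — window regularity (W2), the `κ₃` floor (NG), the lattice gap input (L′) — imply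
`CoincidenceRotationBootstrap.HypercubicLimit` (= `MirrorModularBoosts.WeakCouplingHypercubicLimit`) BY NAME, through the landed
`hypercubicLimit_of_peelInputs` (peeling p125547, λ-Gaussian domination, `stub_uniformBoundPeeled` p126934, host leg (S)
`stub_softLegsU` p133612, `hypercubicLimit_iff_oneFieldWeak` p123041). -/
theorem hypercubicLimit_of_physicsInputs :
    (∀ (G : Type) [Group G] [TopologicalSpace G] [IsTopologicalGroup G] [CompactSpace G]
      [MeasurableSpace G] [BorelSpace G], IsCompactSimpleLieGroup G →
      ∀ (r : LatticeRep G) (β₁ C₁ c₂ : ℝ) (m : ℝ → ℝ), GapData G r β₁ C₁ c₂ m →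
        ∀ c₀ : ℝ, 0 < c₀ → ∃ (lam : ℕ) (C β₀ : ℝ), 1 ≤ lam ∧ ∀ β : ℝ, β₀ ≤ β → ∀ n : ℕ,
          ∃ S₀ : ℕ, ∀ S : ℕ, S₀ ≤ S →
            ∀ (R : ℕ) (o : Fin n → Fin 4 × Fin 4) (x : Fin n → Site 4),
              (∀ k, (o k).1 ≠ (o k).2) → 1 ≤ R → (R : ℝ) ≤ c₀ / m β → 4 * (lam * R) + 4 < 2 * S + 1 →
              (∀ k l, k ≠ l → ∃ μ : Fin 4, (2 * (lam * R) + 1 : ℤ) < |x k μ - x l μ| ∧ |x k μ - x l μ| ≤ S) →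
                ∫ U, ∏ k, ((wilsonMeasure r.ρ β : Measure (GaugeConfig 4 (2 * S + 1) G))[fun U =>
                    |((wilsonMeasure r.ρ β : Measure (GaugeConfig 4 (2 * S + 1) G))[fun U =>
                        torusPlaquette r (2 * S + 1) (o k).1 (o k).2 (x k) U -
                          ∫ V, torusPlaquette r (2 * S + 1) (o k).1 (o k).2 (x k) V
                            ∂(wilsonMeasure r.ρ β : Measure (GaugeConfig 4 (2 * S + 1) G)) |
                      (exterior (2 * S + 1) R (x k) : MeasurableSpace (GaugeConfig 4 (2 * S + 1) G))]) U| |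
                    (exterior (2 * S + 1) (lam * R) (x k) : MeasurableSpace (GaugeConfig 4 (2 * S + 1) G))]) U
                  ∂(wilsonMeasure r.ρ β : Measure (GaugeConfig 4 (2 * S + 1) G)) ≤
                ∏ k, C * influence r β S R (x k) (o k).1 (o k).2 2) →
    CornerFreeInfluence → WindowRegularity → NonGaussianFloor → LatticeGapInput →
      Summit.QuantumFields.YangMills.Theses.CoincidenceRotationBootstrap.HypercubicLimit :=
  fun hF hWI hW2 hNG hL => hypercubicLimit_of_peelInputs hF hWI hW2 hNG hL reflectionLegsP_holds

end Summit.QuantumFields.YangMills.Cruxes.HypercubicLimit.PeelAndDisseminate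

end
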